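import Mathlib
import HarnessLib
import Summits.BirchSwinnertonDyer.BirchSwinnertonDyer.Theses.ManinLocalTwoThree
import Literature.NumberTheory.EllipticCurves.QuadraticTwistTateFormTwoProofs
import Literature.NumberTheory.EllipticCurves.QuadraticTwistJInvariantProofs
import Literature.NumberTheory.EllipticCurves.HasseWeilAbelianConductor
import Literature.NumberTheory.EllipticCurves.RootNumberTwistProofs
import Literature.NumberTheory.EllipticCurves.MazurTorsionPrimeCaseFromCor44Proofs
import Literature.NumberTheory.DiophantineGeometry.ConductorMultiplicativeProofs
import Literature.NumberTheory.EllipticCurves.ManinConstantSemistablePrimewise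
import Literature.NumberTheory.EllipticCurves.ManinConstantQuadraticTwistAtTwoProofs
import Literature.NumberTheory.EllipticCurves.ManinConstantClassCertificateTwist
import Literature.NumberTheory.EllipticCurves.IsogenyConductorModularityProofs
import Literature.NumberTheory.EllipticCurves.ModularParametrizationTrustBaseProofs
import Literature.NumberTheory.EllipticCurves.ModularParametrizationDegreeHoldsProofs
import Literature.NumberTheory.EllipticCurves.IsogenyIdProofs
import Literature.NumberTheory.EllipticCurves.IsogenyDualProofs
import Literature.NumberTheory.EllipticCurves.SzpiroLocalDataProofs
import Literature.NumberTheory.EllipticCurves.NewformsTwistNewProofs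
import Literature.NumberTheory.DiophantineGeometry.ConductorRingOfIntegersProofs
import Literature.NumberTheory.EllipticCurves.QuadraticTwistIntegralModel
import Literature.NumberTheory.EllipticCurves.QuadraticTwistMinimalModelProofs
import Literature.NumberTheory.EllipticCurves.RootNumberSmulProofs

/-!
# Route `ManinLocalTwoThree`, crux C2 `ManinOddAtFour` (stmt-BirchSwinnertonDyer-22967), line
# `dyadic-twist` (planner-of-record imc g8): STUB 2 `stub_dyadicTwistConductor` PROVED — the conductor
# bookkeeping of a `χ₋₄ / χ_{±8}`-twist pair at `2`

The line `Lines/dyadic-twist.lean` refines the birth skeleton of C2: on the twist-covered side the crux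
is `stub_etaTwo` (the cell's `η = 2` leaf E-an-1, BY NAME) + `stub_dyadicTwistConductor` (this file) +
the tree's `η = 1` theorem; the twist-minimal side is `stub_twistMinimalAtTwo`. STUB 2 says: granted
modularity `exists_isNewformOf`, for elliptic `W ∼ W' ⊗ ℚ(√d)`, `d ∈ {−1, 2, −2}`, `W'` globally
minimal with `4 ∤ N(W')` (semistable at `2`) and `W` additive at `2`:
`N(W') ∣ N(W)` and `(4|d|)² ∣ N(W)` — exactly the displayed side conditions of the tree's `Γ₀`
certificates at `2` (`not_dvd_maninConstant_of_isTwistOfSemistableAtTwo_etaOne_gamma0`) and of the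
cell leaves E-an-1 / E-an-2 (`ManinAdditive/TwoNotDvdManinOfTwist*.lean`). PROOF:
* §1–§2 (`N(W') ∣ N(W)`): `N(W) = N(W' ⊗ χ_d)` (isogeny invariance of the conductor granted
  modularity, `conductorNorm_eq_of_isIsogenous_of_modularity`); off `2` the twist by `d = 4k + 1`,
  `k ∈ {−1/2, 1/4, −3/4}` `v`-integral, is unramified, `f_v(W' ⊗ χ_d) = f_v(W')`
  (`conductorExponent_twistModel`, Comalada / Connell); at `2`, `f₂(W') ≤ 1 < 2 ≤ f₂(W)`;
* §3 (`W'` GOOD at `2`): `N(W) = N(W')·(4|d|)²` ON THE MODULAR SIDE — the twist `f' ⊗ χ` of the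
  newform of `W'` by `χ ∈ {χ₋₄, χ₈, χ₋₈}` (conductor `m = 4, 8` coprime to `N(W')`) is a NEWFORM of
  level `N(W') m²` (Atkin–Li 1978 Thm. 3.1, coprime case, PROVED in the tree:
  `isNewform0_charTwist_of_isPrimePow_of_coprime`) with the Fourier coefficients of `W` (odd `n`: the
  twisting identities `LFunction_quadraticTwist_*_apply_of_odd` and isogeny invariance of `L`; even `n`:
  additivity of `W` and `χ(n) = 0`), hence THE newform of `W`, of level `N(W)` (strong multiplicity one);
* §3' (`W'` MULTIPLICATIVE at `2`): `f₂(W' ⊗ χ_d) = 4` (`d = −1`) resp. `6` (`d = ±2`) ON THE LOCAL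
  SIDE — Tate normal form `W' ≅ T^{(d₀)}` with `d₀ ≡ 1 (mod 4)` forced by `f₂(W') = 1`, and
  `W' ⊗ χ_d ≅ T^{(d₀d)}`, `d₀ d ≡ 3` resp. `2 (mod 4)` (tree `QuadraticTwistTateFormTwoProofs`: Ogg's
  formula on Kodaira `I*_{ν+4}` / `I*_{ν+8}`);
* §4 `stub_dyadicTwistConductor`, verbatim the registered signature.
Nothing here proves BSD or Manin's conjecture at `2`. Seat bsd-line-manin23-p2 (prover).
References: [AtkinLi1978] Thm. 3.1; [SilvermanATAEC1994] IV.9.4, IV.10, IV.11.1; [SilvermanAEC2009]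
X.5 Cor. 5.4 and Exercise 4.40 of ATAEC; [DiamondShurman2005] Thm. 8.8.1.
-/

set_option autoImplicit false
set_option linter.dupNamespace false

noncomputable section

open scoped Classical NumberField

namespace Summit.BirchSwinnertonDyer.BirchSwinnertonDyer.Theorems

open WeierstrassCurve IsDedekindDomain IsDedekindDomain.HeightOneSpectrum Rat.HeightOneSpectrum
  Literature.NumberTheory.EllipticCurves Literature.NumberTheory.EllipticCurves.ModularForms

/-- Modularity (`exists_isNewformOf`, with the tree's Eichler–Shimura construction and the PROVED
non-vanishing of the Manin constant) gives a modular parametrisation datum at the conductor level for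
every globally minimal elliptic curve — the schema hypothesis of
`conductorNorm_eq_of_isIsogenous_of_modularity`. [cite: DiamondShurman2005, Thm. 8.8.3] -/
theorem maninLocalTwoThree_nonempty_modularParametrizationData_of_exists_isNewformOf
    (hnf : exists_isNewformOf) : nonempty_modularParametrizationData :=
  nonempty_modularParametrizationData_of_exists_isNewformOf hnf
    IsNewformOf.exists_maninConstant_ne_zero_holds

/-! ## §1 Off `2`, the twist by `d ∈ {−1, 2, −2}` does not change the conductor exponent -/

/-- **`f_v(V ⊗ χ_d) = f_v(V)` at every place `v ∤ 2`, for `d ∈ {−1, 2, −2}`.** The twist by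
`d = 4k + 1`, `k = (d − 1)/4 ∈ {−1/2, 1/4, −3/4}`, is UNRAMIFIED at an odd place `v`
(`|k|_v ≤ 1`, `|d|_v = 1`): `V ⊗ χ_d ≅ V.twistModel k` (tree
`exists_variableChange_twistModel_eq_quadraticTwist`), `f_v(V.twistModel k) = f_v(V)` (tree
`conductorExponent_twistModel`; Comalada 1994 §2, Connell §4.3), and `f_v` is an isomorphism
invariant (`conductorExponent_smul'`). [cite: SilvermanATAEC1994, IV.9.4 (PDF pp. 344–346)] -/
theorem maninLocalTwoThree_conductorExponent_quadraticTwist_eq_of_ne_two (V : WeierstrassCurve ℚ)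
    [V.IsElliptic] {d : ℤ} (hd : d = -1 ∨ d = 2 ∨ d = -2) (v : HeightOneSpectrum ℤ)
    (hv : natGenerator v ≠ 2) :
    (V.quadraticTwist (d : ℚ)).conductorExponent v = V.conductorExponent v := by
  have hgen : (natGenerator v).Prime := prime_natGenerator v
  have hdne : d ≠ 0 := by rcases hd with rfl | rfl | rfl <;> norm_num
  have hd0 : (d : ℚ) ≠ 0 := by exact_mod_cast hdne
  -- `|d|_v = 1`
  have hdv : v.valuation ℚ (d : ℚ) = 1 := by
    rw [Literature.NumberTheory.EllipticCurves.Rat.valuation_intCast_eq_one_iff]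
    intro h
    have h2 : (natGenerator v : ℤ) ∣ 2 := by
      rcases hd with rfl | rfl | rfl
      · exact (dvd_neg.mp h).trans (one_dvd _)
      · exact h
      · exact dvd_neg.mp h
    have h2' : natGenerator v ∣ 2 := by exact_mod_cast h2
    exact hv ((Nat.prime_dvd_prime_iff_eq hgen Nat.prime_two).mp h2')
  -- `|4|_v = 1`
  have h4v : v.valuation ℚ (4 : ℚ) = 1 := by
    rw [show (4 : ℚ) = ((4 : ℤ) : ℚ) by norm_num,
      Literature.NumberTheory.EllipticCurves.Rat.valuation_intCast_eq_one_iff]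
    intro h
    have h2 : (natGenerator v : ℤ) ∣ 2 ^ 2 := by simpa using h
    have h2' : (natGenerator v : ℤ) ∣ 2 := (Nat.prime_iff_prime_int.mp hgen).dvd_of_dvd_pow h2
    have h2'' : natGenerator v ∣ 2 := by exact_mod_cast h2'
    exact hv ((Nat.prime_dvd_prime_iff_eq hgen Nat.prime_two).mp h2'')
  set k : ℚ := ((d : ℚ) - 1) / 4 with hk_def
  have hk4 : 4 * k + 1 = (d : ℚ) := by rw [hk_def]; ring
  have hkv : v.valuation ℚ k ≤ 1 := by
    rw [hk_def, map_div₀, h4v, div_one,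
      show ((d : ℚ) - 1) = algebraMap ℤ ℚ (d - 1) by rw [eq_intCast]; push_cast; ring]
    exact HeightOneSpectrum.valuation_le_one v (d - 1)
  have hk1 : v.valuation ℚ (4 * k + 1) = 1 := by rw [hk4]; exact hdv
  obtain ⟨C₁, -, hC₁⟩ := exists_variableChange_twistModel_eq_quadraticTwist V k
  rw [hk4] at hC₁
  haveI : (V.twistModel k).IsElliptic := by
    refine ⟨?_⟩
    rw [twistModel_Δ, hk4]
    exact (IsUnit.mk0 _ (pow_ne_zero 6 hd0)).mul V.isUnit_Δ
  haveI : (V.quadraticTwist (d : ℚ)).IsElliptic := V.isElliptic_quadraticTwist hd0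
  rw [← hC₁, conductorExponent_smul']
  exact conductorExponent_twistModel v V hkv hk1

/-! ## §2 `N(W') ∣ N(W)` for a twist pair at `2` -/

/-- **`N(W') ∣ N(W)`.** If an elliptic `W/ℚ` additive at `2` is isogenous to `W' ⊗ ℚ(√d)`,
`d ∈ {−1, 2, −2}`, with `4 ∤ N(W')`, then `N(W') ∣ N(W)` (granted modularity): `N(W) = N(W' ⊗ χ_d)`
(`conductorNorm_eq_of_isIsogenous_of_modularity`); off `2` the conductor exponents of `W' ⊗ χ_d` and
`W'` agree (§1), and at `2`, `f₂(W') ≤ 1 < 2 ≤ f₂(W)`.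
[cite: SilvermanATAEC1994, IV.9.4 (PDF pp. 344–346) and Exercise 4.40] -/
theorem maninLocalTwoThree_conductorNorm_dvd_of_isIsogenous_twist_at_two
    (hnf : exists_isNewformOf)
    {W : WeierstrassCurve ℚ} [W.IsElliptic]
    {W' : WeierstrassCurve ℚ} [W'.IsElliptic] {d : ℤ} (hd : d = -1 ∨ d = 2 ∨ d = -2)
    (htw : IsIsogenous W (W'.quadraticTwist (d : ℚ))) (h4' : ¬ 2 ^ 2 ∣ W'.conductorNorm ℤ)
    (hadd : ¬ W.HasGoodReductionAtPrime 2 ∧ ¬ W.HasMultiplicativeReductionAtPrime 2) :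
    W'.conductorNorm ℤ ∣ W.conductorNorm ℤ := by
  have hdne : d ≠ 0 := by rcases hd with rfl | rfl | rfl <;> norm_num
  have hd0 : (d : ℚ) ≠ 0 := by exact_mod_cast hdne
  haveI : (W'.quadraticTwist (d : ℚ)).IsElliptic := W'.isElliptic_quadraticTwist hd0
  have hWV : W.conductorNorm ℤ = (W'.quadraticTwist (d : ℚ)).conductorNorm ℤ :=
    conductorNorm_eq_of_isIsogenous_of_modularity
      (maninLocalTwoThree_nonempty_modularParametrizationData_of_exists_isNewformOf hnf) _ _ htw
  have h4 : 2 ^ 2 ∣ W.conductorNorm ℤ := sq_dvd_conductorNorm_of_not_good_of_not_mult hadd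
  have hB : W.conductorNorm ℤ ≠ 0 := (conductorNorm_pos_holds W).ne'
  refine conductorNorm_dvd_of_forall_conductorExponent_le W' hB fun p ↦ ?_
  rw [factorization_conductorNorm_primesEquiv_symm W p]
  by_cases hp2 : (p : ℕ) = 2
  · -- at `2`: `f₂(W') ≤ 1 < 2 ≤ f₂(W)`
    have h1 : W'.conductorExponent ((primesEquiv (R := ℤ)).symm p) ≤ 1 := by
      rw [← factorization_conductorNorm_primesEquiv_symm W' p, hp2]
      by_contra h
      push Not at h
      exact h4' ((Nat.prime_two.pow_dvd_iff_le_factorization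
        (conductorNorm_pos_holds W').ne').mpr h)
    have h2 : 2 ≤ W.conductorExponent ((primesEquiv (R := ℤ)).symm p) := by
      rw [← factorization_conductorNorm_primesEquiv_symm W p, hp2]
      exact (Nat.prime_two.pow_dvd_iff_le_factorization hB).mp h4
    omega
  · -- off `2`: `f_p(W) = f_p(W' ⊗ χ_d) = f_p(W')`
    have hgen : natGenerator ((primesEquiv (R := ℤ)).symm p) = p :=
      natGenerator_primesEquiv_symm p.2
    have hVW' : (W'.quadraticTwist (d : ℚ)).conductorExponent ((primesEquiv (R := ℤ)).symm p) =
        W'.conductorExponent ((primesEquiv (R := ℤ)).symm p) :=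
      maninLocalTwoThree_conductorExponent_quadraticTwist_eq_of_ne_two W' hd _
        (by rw [hgen]; exact hp2)
    have hWV' : W.conductorExponent ((primesEquiv (R := ℤ)).symm p) =
        (W'.quadraticTwist (d : ℚ)).conductorExponent ((primesEquiv (R := ℤ)).symm p) := by
      rw [← factorization_conductorNorm_primesEquiv_symm W p,
        ← factorization_conductorNorm_primesEquiv_symm _ p, hWV]
    rw [hWV', hVW']

/-! ## §3 `W'` GOOD at `2`: `N(W) = N(W')·m²` by Atkin–Li (coprime case, PROVED in the tree) -/

/-- **Conductor of a twist pair at `2`, good case, generic character.** Let `W ∼ W' ⊗ ℚ(√d)` with `W`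
additive at `2`, and let `χ` be a primitive quadratic character mod a prime power `m` coprime to
`N(W')`, vanishing at even `n` and carrying the odd-`n` twisting identity `aₙ(W' ⊗ d) = χ(n) aₙ(W')`.
Then `N(W) = N(W')·m²`: the twist `f' ⊗ χ` of the newform `f'` of `W'` is a NEWFORM of level `N(W')·m²`
(Atkin–Li 1978 Thm. 3.1, coprime case — tree theorem `isNewform0_charTwist_of_isPrimePow_of_coprime`)
with the Fourier coefficients of `W` (odd `n`: the twisting identity and isogeny invariance of `L`;
even `n`: `W` is additive at `2` and `χ(n) = 0`), so it is THE newform of `W` and its level is `N(W)`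
(strong multiplicity one, `IsNewformOf.level_eq_conductorNorm_of_exists_isNewformOf`).
[cite: AtkinLi1978, §3, Thm. 3.1] [cite: DiamondShurman2005, Thm. 8.8.1] -/
theorem maninLocalTwoThree_conductorNorm_eq_mul_sq_of_twist_of_char
    (hnf : exists_isNewformOf)
    {W : WeierstrassCurve ℚ} [W.IsElliptic]
    {W' : WeierstrassCurve ℚ} [W'.IsElliptic] {d : ℤ} (hd0 : d ≠ 0)
    {m : ℕ} [NeZero m] {χ : DirichletCharacter ℂ m} (hχq : χ.IsQuadratic) (hχp : χ.IsPrimitive)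
    (hm : IsPrimePow m) (hcop : (W'.conductorNorm ℤ).Coprime m)
    (hχodd : ∀ n : ℕ, ¬ 2 ∣ n →
      (((W'.quadraticTwist (d : ℚ)).LFunction n : ℤ) : ℂ) = χ n * ((W'.LFunction n : ℤ) : ℂ))
    (hχeven : ∀ n : ℕ, 2 ∣ n → χ n = 0)
    (htw : IsIsogenous W (W'.quadraticTwist (d : ℚ)))
    (hadd : ¬ W.HasGoodReductionAtPrime 2 ∧ ¬ W.HasMultiplicativeReductionAtPrime 2) :
    W.conductorNorm ℤ = W'.conductorNorm ℤ * m ^ 2 := by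
  have hd0' : (d : ℚ) ≠ 0 := by exact_mod_cast hd0
  haveI : (W'.quadraticTwist (d : ℚ)).IsElliptic := W'.isElliptic_quadraticTwist hd0'
  haveI : NeZero (W'.conductorNorm ℤ) := ⟨(conductorNorm_pos_holds W').ne'⟩
  haveI : NeZero (W'.conductorNorm ℤ * m ^ 2) :=
    ⟨mul_ne_zero (NeZero.ne _) (pow_ne_zero 2 (NeZero.ne m))⟩
  obtain ⟨f', hf'⟩ := hnf W'
  have hF : IsNewform0 (charTwist (W'.conductorNorm ℤ * m ^ 2) (dvd_mul_right _ _)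
      (dvd_mul_left _ _) hχq f') :=
    isNewform0_charTwist_of_isPrimePow_of_coprime hχq hχp hm hcop hf'.1
  have hLtw : W.LFunction = (W'.quadraticTwist (d : ℚ)).LFunction :=
    LFunction_eq_of_isIsogenous_holds _ _ htw
  have hFW : IsNewformOf W (charTwist (W'.conductorNorm ℤ * m ^ 2) (dvd_mul_right _ _)
      (dvd_mul_left _ _) hχq f') := by
    refine ⟨hF, fun n ↦ ?_⟩
    rw [cuspCoeff_charTwist _ _ _ hχq hχp f' n, hf'.2 n]
    by_cases h2n : 2 ∣ n
    · have h0 : W.LFunction n = 0 :=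
        W.LFunction_apply_eq_zero_of_not_good_of_not_mult 2 hadd.1 hadd.2 h2n
      rw [h0, hχeven n h2n]
      simp
    · have hLn : W.LFunction n = (W'.quadraticTwist (d : ℚ)).LFunction n := by rw [hLtw]
      rw [hLn, hχodd n h2n]
  exact (IsNewformOf.level_eq_conductorNorm_of_exists_isNewformOf hnf hFW).symm

/-- **Good case: `N(W) = N(W')·(4|d|)²`** for `W ∼ W' ⊗ ℚ(√d)`, `d ∈ {−1, 2, −2}`, `W` additive at `2`,
`W'` GOOD at `2` (`2 ∤ N(W')`): the characters are `χ₋₄, χ₈, χ₋₈` (conductors `4, 8, 8`), with the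
tree's odd-`n` twisting identities `LFunction_quadraticTwist_{neg_one,two,neg_two}_apply_of_odd`. So
`v₂(N(W)) = 4` resp. `6`. [cite: AtkinLi1978, §3, Thm. 3.1] [cite: SilvermanAEC2009, X.5 Cor. 5.4] -/
theorem maninLocalTwoThree_conductorNorm_eq_of_twist_of_good_at_two
    (hnf : exists_isNewformOf)
    {W : WeierstrassCurve ℚ} [W.IsElliptic]
    {W' : WeierstrassCurve ℚ} [W'.IsElliptic] {d : ℤ} (hd : d = -1 ∨ d = 2 ∨ d = -2)
    (htw : IsIsogenous W (W'.quadraticTwist (d : ℚ)))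
    (hadd : ¬ W.HasGoodReductionAtPrime 2 ∧ ¬ W.HasMultiplicativeReductionAtPrime 2)
    (h2' : ¬ 2 ∣ W'.conductorNorm ℤ) :
    W.conductorNorm ℤ = W'.conductorNorm ℤ * (4 * d.natAbs) ^ 2 := by
  have hcop2 : (W'.conductorNorm ℤ).Coprime 2 :=
    Nat.coprime_comm.mp ((Nat.Prime.coprime_iff_not_dvd Nat.prime_two).mpr h2')
  have hcop4 : (W'.conductorNorm ℤ).Coprime 4 := by
    simpa using hcop2.pow_right 2
  have hcop8 : (W'.conductorNorm ℤ).Coprime 8 := by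
    simpa using hcop2.pow_right 3
  have hpp4 : IsPrimePow 4 := (isPrimePow_nat_iff 4).mpr ⟨2, 2, Nat.prime_two, by norm_num, by norm_num⟩
  have hpp8 : IsPrimePow 8 := (isPrimePow_nat_iff 8).mpr ⟨2, 3, Nat.prime_two, by norm_num, by norm_num⟩
  rcases hd with rfl | rfl | rfl
  · -- `χ₋₄`
    have h := maninLocalTwoThree_conductorNorm_eq_mul_sq_of_twist_of_char hnf (d := -1)
      (by norm_num) isQuadratic_χ₄_ringHomComp isPrimitive_χ₄_ringHomComp hpp4 hcop4
      (fun n hn ↦ ?_) (fun n hn ↦ ?_) htw hadd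
    · simpa using h
    · rw [show ((-1 : ℤ) : ℚ) = -1 by norm_num, W'.LFunction_quadraticTwist_neg_one_apply_of_odd hn,
        Int.cast_mul, χ₄_ringHomComp_apply_natCast]
    · rw [χ₄_ringHomComp_apply_natCast, ZMod.χ₄_nat_eq_if_mod_four, if_pos (Nat.mod_eq_zero_of_dvd hn)]
      simp
  · -- `χ₈`
    have h := maninLocalTwoThree_conductorNorm_eq_mul_sq_of_twist_of_char hnf (d := 2)
      (by norm_num) isQuadratic_χ₈_ringHomComp isPrimitive_χ₈_ringHomComp hpp8 hcop8
      (fun n hn ↦ ?_) (fun n hn ↦ ?_) htw hadd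
    · simpa using h
    · rw [show ((2 : ℤ) : ℚ) = 2 by norm_num, W'.LFunction_quadraticTwist_two_apply_of_odd hn,
        Int.cast_mul, χ₈_ringHomComp_apply_natCast]
    · rw [χ₈_ringHomComp_apply_natCast, ZMod.χ₈_nat_eq_if_mod_eight,
        if_pos (Nat.mod_eq_zero_of_dvd hn)]
      simp
  · -- `χ₋₈`
    have h := maninLocalTwoThree_conductorNorm_eq_mul_sq_of_twist_of_char hnf (d := -2)
      (by norm_num) isQuadratic_χ₈'_ringHomComp isPrimitive_χ₈'_ringHomComp hpp8 hcop8
      (fun n hn ↦ ?_) (fun n hn ↦ ?_) htw hadd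
    · simpa using h
    · rw [show ((-2 : ℤ) : ℚ) = -2 by norm_num, W'.LFunction_quadraticTwist_neg_two_apply_of_odd hn,
        Int.cast_mul, χ₈'_ringHomComp_apply_natCast]
    · rw [χ₈'_ringHomComp_apply_natCast, ZMod.χ₈'_nat_eq_if_mod_eight,
        if_pos (Nat.mod_eq_zero_of_dvd hn)]
      simp

/-! ## §3' LEMMA B, `W'` MULTIPLICATIVE at `2`: `f₂(W' ⊗ χ_d) = 4, 6` by the Tate normal form -/

/-- **Conductor exponent at `2` of the `χ₋₄ / χ_{±8}`-twist of a curve MULTIPLICATIVE at `2`.**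
For `W'/ℚ` multiplicative at `2` and `d ∈ {−1, 2, −2}`: `2⁴ ∣ N(W' ⊗ ℚ(√−1))`,
`2⁶ ∣ N(W' ⊗ ℚ(√±2))` (in fact `f₂ = 4`, `6`). Via the Tate normal form `T = tateFormOfJ j`:
`W' ≅ T^{(d₀)}` with `4 ∤ d₀` (`exists_int_variableChange_eq_quadraticTwist_tateFormOfJ`), and
`f₂(W') = 1` rules out `d₀ ≡ 2, 3 (mod 4)` (which give `f₂ = 6, 4`:
`conductorExponent_eq_six/four_of_emod_four_eq_two/three`), so `d₀ ≡ 1 (mod 4)`; then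
`W' ⊗ χ_d ≅ T^{(d₀ d)}` with `d₀ d ≡ 3 (mod 4)` (`d = −1`: `f₂ = 4`) or `≡ 2 (mod 4)` (`d = ±2`:
`f₂ = 6`). Stated at a prime `p = 2` so that the place over `p` can be substituted (pattern of
`TwoAdicGoodTwists.hasMultiplicativeReductionAtPrime_of_smul_eq_quadraticTwist_two`).
[cite: SilvermanATAEC1994, IV.11.1 (Ogg's formula) and Table 4.1] [cite: SilvermanAEC2009, X.5 Cor. 5.4.1] -/
theorem maninLocalTwoThree_pow_dvd_conductorNorm_quadraticTwist_of_mult_two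
    (W' : WeierstrassCurve ℚ) [W'.IsElliptic] {d : ℤ} (hd : d = -1 ∨ d = 2 ∨ d = -2)
    [(W'.quadraticTwist (d : ℚ)).IsElliptic]
    (p : ℕ) [Fact p.Prime] (hp : p = 2) (hmult : W'.HasMultiplicativeReductionAtPrime p) :
    2 ^ (if d = -1 then 4 else 6) ∣ (W'.quadraticTwist (d : ℚ)).conductorNorm ℤ := by
  obtain ⟨v, rfl⟩ : ∃ v : HeightOneSpectrum (𝓞 ℚ), ((primesEquiv v : ℕ)) = p :=
    ⟨primesEquiv.symm ⟨p, Fact.out⟩, by rw [Equiv.apply_symm_apply]⟩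
  have hv : natGenerator v = 2 := hp
  haveI := perfectField_residueField_adicCompletionIntegers (K := ℚ) v
  have hdne : d ≠ 0 := by rcases hd with rfl | rfl | rfl <;> norm_num
  have hd0 : (d : ℚ) ≠ 0 := by exact_mod_cast hdne
  set V : WeierstrassCurve ℚ := W'.quadraticTwist (d : ℚ) with hVdef
  have hmv : W'.HasMultiplicativeReductionAt v :=
    (W'.hasMultiplicativeReductionAtPrime_iff_hasMultiplicativeReductionAt_ringOfIntegers v).mp hmult
  have hj : 1 < v.valuation ℚ W'.j :=
    one_lt_valuation_j_of_hasMultiplicativeReduction_localMinimalModel v W' hmv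
  obtain ⟨hj0, hj1728, -⟩ := W'.j_ne_and_valuation_j_sub_eq_of_one_lt_valuation_j v hj
  obtain ⟨d₀, -, hd₀4, C₀, hC₀⟩ :=
    W'.exists_int_variableChange_eq_quadraticTwist_tateFormOfJ hj0 hj1728
  have hf1 : W'.conductorExponent v = 1 := (conductorExponent_eq_one_iff_holds v W').mpr hmv
  have h1 : d₀ % 4 = 1 := by
    have hcases : d₀ % 4 = 1 ∨ d₀ % 4 = 2 ∨ d₀ % 4 = 3 := by omega
    rcases hcases with h | h | h
    · exact h
    · have h6 := (conductorExponent_eq_six_of_emod_four_eq_two v hv W' hj h hC₀).1; omega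
    · have h4 := (conductorExponent_eq_four_of_emod_four_eq_three v hv W' hj h hC₀).1; omega
  have hjV : V.j = W'.j := W'.j_quadraticTwist hd0
  have hW' : W' = C₀⁻¹ • (tateFormOfJ W'.j).quadraticTwist (d₀ : ℚ) := by
    rw [← hC₀, inv_smul_smul]
  have h2 : V = (C₀⁻¹ • (tateFormOfJ W'.j).quadraticTwist (d₀ : ℚ)).quadraticTwist (d : ℚ) :=
    congrArg (fun X : WeierstrassCurve ℚ => X.quadraticTwist (d : ℚ)) hW'
  set C₁ : VariableChange ℚ := ⟨C₀⁻¹.u, (d : ℚ) * C₀⁻¹.r, 0, 0⟩ with hC₁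
  have hC' : C₁⁻¹ • V = (tateFormOfJ V.j).quadraticTwist ((d₀ * d : ℤ) : ℚ) := by
    rw [hjV, h2, quadraticTwist_smul, quadraticTwist_quadraticTwist, ← hC₁, inv_smul_smul, Int.cast_mul]
  have hjV' : 1 < v.valuation ℚ V.j := by rw [hjV]; exact hj
  -- the conductor exponent of `V` at `2`
  have hfV : V.conductorExponent v = if d = -1 then 4 else 6 := by
    rcases hd with rfl | rfl | rfl
    · have hdd : (d₀ * (-1 : ℤ)) % 4 = 3 := by rw [Int.mul_emod, h1]; norm_num
      rw [if_pos rfl]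
      exact (conductorExponent_eq_four_of_emod_four_eq_three v hv V hjV' hdd hC').1
    · have hdd : (d₀ * (2 : ℤ)) % 4 = 2 := by rw [Int.mul_emod, h1]; norm_num
      rw [if_neg (by norm_num)]
      exact (conductorExponent_eq_six_of_emod_four_eq_two v hv V hjV' hdd hC').1
    · have hdd : (d₀ * (-2 : ℤ)) % 4 = 2 := by rw [Int.mul_emod, h1]; norm_num
      rw [if_neg (by norm_num)]
      exact (conductorExponent_eq_six_of_emod_four_eq_two v hv V hjV' hdd hC').1
  -- to the `ℤ`-conductor
  have hfac : (V.conductorNorm ℤ).factorization (primesEquiv v : ℕ) = V.conductorExponent v := by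
    rw [factorization_conductorNorm_primesEquiv_symm V (primesEquiv v),
      ← conductorExponent_ringOfIntegers_eq V v]
  rw [hp] at hfac
  exact (Nat.prime_two.pow_dvd_iff_le_factorization (conductorNorm_pos_holds V).ne').mpr
    (by rw [hfac, hfV])

/-- **Multiplicative case: `(4|d|)² ∣ N(W)`** for `W ∼ W' ⊗ ℚ(√d)`, `d ∈ {−1, 2, −2}`, `W'`
MULTIPLICATIVE at `2`: `N(W) = N(W' ⊗ χ_d)` (isogeny invariance, granted modularity) and §3'.
[cite: SilvermanATAEC1994, IV.11.1, Table 4.1 and Exercise 4.40] -/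
theorem maninLocalTwoThree_sq_dvd_conductorNorm_of_twist_of_mult_at_two
    (hnf : exists_isNewformOf)
    {W : WeierstrassCurve ℚ} [W.IsElliptic]
    {W' : WeierstrassCurve ℚ} [W'.IsElliptic] {d : ℤ} (hd : d = -1 ∨ d = 2 ∨ d = -2)
    (htw : IsIsogenous W (W'.quadraticTwist (d : ℚ)))
    (hmult : W'.HasMultiplicativeReductionAtPrime 2) :
    (4 * d.natAbs) ^ 2 ∣ W.conductorNorm ℤ := by
  have hdne : d ≠ 0 := by rcases hd with rfl | rfl | rfl <;> norm_num
  have hd0 : (d : ℚ) ≠ 0 := by exact_mod_cast hdne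
  haveI : (W'.quadraticTwist (d : ℚ)).IsElliptic := W'.isElliptic_quadraticTwist hd0
  have hWV : W.conductorNorm ℤ = (W'.quadraticTwist (d : ℚ)).conductorNorm ℤ :=
    conductorNorm_eq_of_isIsogenous_of_modularity
      (maninLocalTwoThree_nonempty_modularParametrizationData_of_exists_isNewformOf hnf) _ _ htw
  have h := maninLocalTwoThree_pow_dvd_conductorNorm_quadraticTwist_of_mult_two W' hd 2 rfl hmult
  rw [← hWV] at h
  rcases hd with rfl | rfl | rfl
  · simpa using h
  · simpa using h
  · simpa using h

/-! ## §4 The registered stub of line `dyadic-twist`, verbatim -/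

/-- **Line `dyadic-twist` of crux `ManinOddAtFour` (stmt-BirchSwinnertonDyer-22967), STUB 2
`stub_dyadicTwistConductor`, PROVED AS REGISTERED**: granted the Modularity Theorem
`exists_isNewformOf`, for elliptic `W ∼ W' ⊗ ℚ(√d)` with `d ∈ {−1, 2, −2}`, `W'` globally minimal and
semistable at `2` (`4 ∤ N(W')`), `W` additive at `2`: `N(W') ∣ N(W)` (§2) and `(4|d|)² ∣ N(W)` (§3 if
`W'` is good at `2`, §3' if multiplicative). [cite: AtkinLi1978, §3, Thm. 3.1]
[cite: SilvermanATAEC1994, IV.9.4, IV.11.1] -/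
theorem stub_dyadicTwistConductor :
    exists_isNewformOf →
    ∀ {W : WeierstrassCurve ℚ} [W.IsElliptic] {W' : WeierstrassCurve ℚ} [W'.IsElliptic]
      [W'.IsGloballyMinimal] {d : ℤ}, (d = -1 ∨ d = 2 ∨ d = -2) →
      IsIsogenous W (W'.quadraticTwist (d : ℚ)) → ¬ 2 ^ 2 ∣ W'.conductorNorm ℤ →
      (¬ W.HasGoodReductionAtPrime 2 ∧ ¬ W.HasMultiplicativeReductionAtPrime 2) →
      W'.conductorNorm ℤ ∣ W.conductorNorm ℤ ∧ (4 * d.natAbs) ^ 2 ∣ W.conductorNorm ℤ := by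
  intro hnf W _ W' _ _ d hd htw h4' hadd
  refine ⟨maninLocalTwoThree_conductorNorm_dvd_of_isIsogenous_twist_at_two hnf hd htw h4' hadd, ?_⟩
  rcases hasGoodReductionAtPrime_or_hasMultiplicativeReductionAtPrime_of_not_sq_dvd_conductorNorm h4'
    with hgood | hmult
  · have h2' : ¬ 2 ∣ W'.conductorNorm ℤ := fun h2 ↦
      ((dvd_conductorNorm_iff_not_hasGoodReductionAtPrime W' 2).mp h2) hgood
    rw [maninLocalTwoThree_conductorNorm_eq_of_twist_of_good_at_two hnf hd htw hadd h2']
    exact dvd_mul_left _ _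
  · exact maninLocalTwoThree_sq_dvd_conductorNorm_of_twist_of_mult_at_two hnf hd htw hmult

end Summit.BirchSwinnertonDyer.BirchSwinnertonDyer.Theorems

end
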